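import Literature.MathematicalPhysics.QuantumFieldTheory.Balaban1983to89.B13Lemma3WindowCauchy
import Literature.MathematicalPhysics.QuantumFieldTheory.Balaban1983to89.B13Bound226Primitive

/-!
# `Balaban1983to89.B13Lemma3WindowPrimitive` — T. Bałaban, *Renormalization group approach to lattice gauge field
theories. II. Cluster expansions*, Commun. Math. Phys. **116** (1988) 1–22 [Balaban1988RG2Cluster], pp. 15–17: on the
two-scale window model, the hypothesis «(2.26) FOR EVERY TERM» of Lemma 3 / of the §2 chain
(`B13Lemma3WindowTerms.bound238_window_of_226`, `B13Lemma3WindowChain.deliverables_window_of_226`) supplied, term by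
term, by the PRIMITIVE-OBJECT capstone `B13Bound226Primitive.norm_term214_le_226_of_primitives` — the joiner that closes
the window-model chain from the primitive cross-paper inputs of pp. 15–16 instead of «(2.26) per term»

statement-level skeleton of published theorems with citation tags; proofs where landed; nothing here is a claim about
the Yang–Mills mass gap

PDF held: `paper:balaban1988-cmp116-rg-ii-cluster` (journal page = PDF page + 0); pp. 15–17 (materialised
`p0015.txt`–`p0017.txt`, renders `pub-balaban/b2b-balaban-ref1/pages/1988-cmp116-rg-II-cluster/…-p015/p016/p017-x2.png`;
quoted in full in `B13Term214`, `B13CauchyDecay`, `B13Bound226Primitive`, `B13Lemma3WindowTerms`).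

CITATION HEADER (verbatim, p. 17 [PDF 17]): *"This ends the estimate of the expression (2.14). Gathering together all the
bounds we get*
`|(2.14)| ≦ exp(−(κ₁ − 1)(LM)⁻⁴|Z∖Z′₀|)[Π_{Y∈𝐃} 2E₀ε₁C₁α₄⁻¹M^q exp C₂κ₁ exp(−(1 − 3δ)κd_k(Y))] exp(−½γ₂(ε₁²/g_k²)|P|) · exp O(1)α₅|Z|.`
(2.26) *To get a bound for H(Z) we have to perform the resummation of the terms (2.14) over 𝐃, P and Z₀. … To bound H(Z) we
use the estimate (2.26) for terms of these sums"*; p. 16 [PDF 16]: *"1/|τ(Y)| = E₀ε₁C₁α₄⁻¹M^q exp C₂κ₁ exp(−(1 − 3δ)κd_k(Y))"*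
(2.18).  The volume factors (the sentences actually printed; v1.1 docfix, referee finding ref-5 L-g33 (b)): p. 16 [PDF 16]
*"the determinants in the next factor are equal for the new operators, hence this factor can be estimated by*
`exp((O(1)e^{−⅓δ₀M} + O(α₀ + α₁))|Z₀|)`*"* (2.17); p. 17 [PDF 17], below (2.24): *"The factor with the determinants can
be estimated by exp O(1)α₅|Z₀|."*; (2.25) p. 17: `∫dμ₀(X)|_Z exp ½O(α₅)‖ZX‖² = Π_{b∈Z}(1 − O(α₅))^{−1/2} ≦ exp(O(α₅)|Z|)`;
p. 20 [PDF 20] ll. 22–25: *"This exponential is of the same type as the last exponential in (2.37), which can be written as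
exp O(1)(LM)⁴α₅(LM)⁻⁴|Z|. Let us recall the definition of the constant α₅: α₅ = O(1)e^{−⅓δ₀M} + O(α₀ + α₁) + O(1)α₄ + γ₂."*
(v1 of this header rendered these as one sentence «the volume factors above can be bounded by exp O(1)(α₀ + α₁)|Z|, so
they are of the same type as the last factor in (2.26)», which is a PARAPHRASE, not print; the Lean statement is unchanged.)

WHAT IS REPRODUCED (unit `lit-balaban-r10` gen 13, B13 fold owner; SKELETON rows `B13.Eq2.26`, `B13.Eq2.18`, `B13.Lem3`
of `HOME/lit-balaban-r10/ROWS-B13.md`, HOME = `run/shared/lean/pub/lit-balaban/`; kind «model-instance joiner», one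
theorem, the optional item (i) of `HOME/lit-balaban-r10/B13-CLOSURE.md` §5 in its single-term form).
**`h226_of_primitives`**: for ONE term `t = (𝐃, P)` of the activity `H(Z)` on the window model, realized as the generic
term (2.14) `B13Term214.term214 r lZ lD (core214 A Γ (F214 |P| χY₀ χcP Dfam V)) 0 0` with σ-parameters `lZ` = an
enumeration of the LM-cubes of `Z∖Z′₀` and τ-parameters `lD` = an enumeration of `𝐃` (exactly as in
`B13Lemma3WindowCauchy.h226_of_cauchy`), the τ-radii being the printed ones `|τ(Y)| = (invTau c (d_k Y))⁻¹` of (2.18)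
(`0 < invTau ≤ ½`), and with EVERY OTHER HYPOTHESIS THE PRIMITIVE DATA of `B13Bound226Primitive.norm_term214_le_226_of_primitives`
(separate analyticity in (σ, τ); `A(σ)` symmetric with `Re A(σ) ≻ 0`; the `Γ`-operator linear with kernel `G(σ)`; the
(2.22)/(2.20) shapes; uniform localisation of `G(σ)`, `Γ₀`, `A(σ)⁻¹`, `C` and the (2.16)-type difference bounds on located
bonds; the smallness `K′θ′ < 1`, `α₅c ≤ ½`, `α₅(1+2cg) ≤ ½`), the conclusion is (2.26) IN THE EXACT SPELLING of the
hypothesis `h226` of `B13Lemma3WindowTerms.hrep_of_termwise` / `bound238_window_of_226` /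
`B13Lemma3WindowChain.deliverables_window_of_226`: `‖(2.14)‖ ≤ weight c L M Z a t · exp(a₅·#cells Z)`, GIVEN the two
constant-matching facts of p. 17: the `|P|`-rate of the weight is at most the printed `γ₂(ε₁²/g_k²)` (`hPa : a ≤ γ₂·r_P²`),
and the volume bookkeeping (print: (2.17) p. 16, *"The factor with the determinants can be estimated by exp O(1)α₅|Z₀|"*
and (2.25) *"≦ exp(O(α₅)|Z|)"* p. 17) — the exponents of the three volume factors of (2.24)–(2.25) plus the additive
constant `w` of the (2.20) shape are at most `a₅·#LM-cubes(Z)` (`hvol`).  Proof =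
`norm_term214_le_226_of_primitives` at `R_τ(Y) := (invTau c (d_k Y))⁻¹ ≥ 2`, then `|lZ| = #cells(Z∖Z′₀)`,
`2·invTau c d = α₆ε₂e^{−(1−3δ)κd}` (`B13CauchyDecay.two_mul_invTau_eq`, `α₆ ≠ 0`) and monotonicity of `exp`.

HONEST SCOPE.  A pure joiner (no analysis beyond the two landed theorems it composes; no `sorry`, no definition, no new
named fact — D-0026).  With it, the window-model §2 chain `deliverables_window_of_226` runs, upstream of the resummation
and term by term, from exactly the by-assertion inputs listed in `B13Bound226Primitive` (the localisation and difference
bounds of the PRIMITIVE operators `C^{(k)}(Z₀,σ)`, its inverse, `Γ_k(Z₀,σ)` — cross-paper [13]/[15], loci L16a/L17a of the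
cell transcript —, the eigenvalue/norm letters `c`, `g`, the (2.20)/(2.22) shapes, separate analyticity) plus the
(2.14)-representation of `H(Z)` (`B13Representation214`), the volume bookkeeping `hvol`, and the chain's own downstream
inputs (the log Z^{(k)} half, (I.1.7), analyticity in (U, J), gauge invariance).  The window model's readings (free boundary,
over-counted term set, endpoint reading of Z₀ — HOME GAPS G-B13-P12-01) are those of `B13Lemma3WindowTerms`; bonds are
located on ℤ^ν (`locΛ`, `locN`) as in the capstone.
-/

namespace Literature.MathematicalPhysics.QuantumFieldTheory.Balaban1983to89.B13Lemma3WindowPrimitive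

open Metric Set Matrix
open Literature.MathematicalPhysics.QuantumFieldTheory.Balaban1983to89
open Literature.MathematicalPhysics.QuantumFieldTheory.Balaban1983to89.B13ScaleTransfer (Pt collar closureIdx)
open Literature.MathematicalPhysics.QuantumFieldTheory.Balaban1983to89.TreeLengthCubeSystem (Dom sys Cell cellsOf)
open Literature.MathematicalPhysics.QuantumFieldTheory.Balaban1983to89.B13Lemma3Window (LBond)
open Literature.MathematicalPhysics.QuantumFieldTheory.Balaban1983to89.B13Lemma3WindowTerms (weight Z0)
open Literature.MathematicalPhysics.QuantumFieldTheory.Balaban1983to89.B13Term214 (term214 SepHolOn core214 F214)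
open Literature.MathematicalPhysics.QuantumFieldTheory.Balaban1983to89.B13Bound143 (invTau)
open Literature.MathematicalPhysics.QuantumFieldTheory.Balaban1983to89.B13CauchyDecay (two_mul_invTau_eq)
open Literature.MathematicalPhysics.QuantumFieldTheory.Balaban1983to89.B2Lemma25Proof (l1dist)
open Literature.MathematicalPhysics.QuantumFieldTheory.Balaban1983to89.B13Bound226Primitive
  (norm_term214_le_226_of_primitives)

noncomputable section

variable {d ν : ℕ} {Λ : Type} [Fintype Λ] [DecidableEq Λ] {C₀ : Type} [Fintype C₀] [DecidableEq C₀]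

open Classical in
/-- **(2.26) FOR ONE TERM of the window model, from the PRIMITIVE objects** — p. 17 *"Gathering together all the bounds
we get (2.26)"* in the spelling consumed by the resummation (`B13Lemma3WindowTerms.hrep_of_termwise`, hypothesis `h226`):
if the term `t = (𝐃, P)` of `H(Z)` is the generic term (2.14) `term214 r lZ lD (core214 A Γ (F214 |P| χY₀ χcP Dfam V)) 0 0`
(σ-parameters `lZ` = the LM-cubes of `Z∖Z′₀`, τ-parameters `lD` = `𝐃`, τ-radii `|τ(Y)| = (invTau c (d_k Y))⁻¹` of (2.18)
with `0 < invTau ≤ ½`), and the primitive data of `B13Bound226Primitive.norm_term214_le_226_of_primitives` hold (separate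
analyticity; `A(σ)` symmetric, `Re A(σ) ≻ 0`; linear `Γ(σ) = G(σ)·`; the (2.22)/(2.20) shapes with constants `γ₂, r_P, a₂₀,
w`; located bonds with `≤ m` per site; uniform localisation of `G(σ)`, `Γ₀`, `A(σ)⁻¹`, `C` and the (2.16)-type difference
bounds at rates `κ > κ′ > κ″ > 0`; the smallness conditions), then
`‖(2.14)‖ ≤ weight c L M Z a t · exp(a₅ · #cells Z)` as soon as `a ≤ γ₂ r_P²` (the weight's `|P|`-rate is at most the
printed `½γ₂(ε₁²/g_k²)`) and the volume exponents of (2.24)–(2.25) plus `w` are at most `a₅ · #cells Z` (print: (2.17)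
p. 16; p. 17 *"The factor with the determinants can be estimated by exp O(1)α₅|Z₀|"*; (2.25) *"≦ exp(O(α₅)|Z|)"*).
[cite: Balaban1988RG2Cluster, (2.14)–(2.15) p.15, (2.16)–(2.22) p.16, (2.23)–(2.26) p.17] -/
theorem h226_of_primitives (c : B13.Consts) (hκ₁ : 1 ≤ c.κ₁) (hα₆ : c.α₆ ≠ 0) {L M : ℕ} {Bk Bk1 : Finset (Pt d)}
    (Z : Dom Bk1) (t : Finset (Dom Bk) × Finset (LBond d))
    (hpos : ∀ Y : Dom Bk, 0 < invTau c ((sys Bk).dj Y)) (hhalf : ∀ Y : Dom Bk, invTau c ((sys Bk).dj Y) ≤ 1 / 2)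
    {Uσ Uτ : Set ℂ} (hUσ : IsOpen Uσ) (hUτ : IsOpen Uτ) (hUexp : closedBall (0 : ℂ) (Real.exp c.κ₁) ⊆ Uσ)
    (hUtau : ∀ Y : Dom Bk, closedBall (0 : ℂ) ((invTau c ((sys Bk).dj Y))⁻¹) ⊆ Uτ)
    {r : ℝ} (hr : 0 < r) (hr' : r ≤ Real.exp c.κ₁ - 1)
    (hsubτ : ∀ s ∈ Set.uIcc (0 : ℝ) 1, closedBall (s : ℂ) r ⊆ Uτ)
    -- the parameter lists of the term: σ over the LM-cubes of Z∖Z′₀, τ over 𝐃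
    (lZ : List (Cell Bk1)) (hlZ : lZ.Nodup ∧ lZ.toFinset = cellsOf Bk1 (Z.1 \ closureIdx L (collar (Z0 M t))))
    (lD : List (Dom Bk)) (hlD : lD.Nodup ∧ lD.toFinset = t.1)
    -- the (2.14)-data of the term
    (A : (Cell Bk1 → ℂ) → Matrix Λ Λ ℂ) (Γ : (Cell Bk1 → ℂ) → (Λ ⊕ C₀ → ℝ) → (Λ → ℂ))
    (χY₀ χcP : (Λ → ℝ) → ℝ) (hχ0 : ∀ B, 0 ≤ χY₀ B) (hχc0 : ∀ B, 0 ≤ χcP B) (Dfam : Finset (Dom Bk))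
    (V : Dom Bk → (Λ → ℝ) → ℂ)
    (hΨσ : ∀ τ : Dom Bk → ℂ, (∀ j, τ j ∈ Uτ) →
      SepHolOn Uσ (fun σ => core214 A Γ (F214 t.2.card χY₀ χcP Dfam V) σ τ))
    (hΨτ : ∀ σ : Cell Bk1 → ℂ, (∀ j, σ j ∈ Uσ) →
      SepHolOn Uτ (fun τ => core214 A Γ (F214 t.2.card χY₀ χcP Dfam V) σ τ))
    {C : Matrix Λ Λ ℝ} (hC : C.PosDef) (Γ₀ : Matrix Λ (Λ ⊕ C₀) ℝ)
    (hAs : ∀ σ : Cell Bk1 → ℂ, (∀ j, ‖σ j‖ ≤ Real.exp c.κ₁) → (A σ).IsSymm)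
    (hA : ∀ σ : Cell Bk1 → ℂ, (∀ j, ‖σ j‖ ≤ Real.exp c.κ₁) → ((A σ).map Complex.re).PosDef)
    -- the Γ-operator is linear with kernel G(σ)
    (G : (Cell Bk1 → ℂ) → Matrix Λ (Λ ⊕ C₀) ℂ)
    (hlin : ∀ σ : Cell Bk1 → ℂ, (∀ j, ‖σ j‖ ≤ Real.exp c.κ₁) →
      ∀ X : Λ ⊕ C₀ → ℝ, Γ σ X = G σ *ᵥ fun j => (X j : ℂ))
    -- the (2.22) and (2.20) shapes
    {γ₂ rP a₂₀ w : ℝ} (qP : (Λ → ℝ) → ℝ)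
    (h222 : ∀ B, χY₀ B * χcP B ≤ Real.exp (-(γ₂ / 2 * rP ^ 2 * (t.2.card : ℕ)) + γ₂ / 2 * qP B)) (hγ₂ : 0 ≤ γ₂)
    (hqP : ∀ B, qP B ≤ B ⬝ᵥ B)
    (h220R : ∀ B, ∑ Y ∈ Dfam, (invTau c ((sys Bk).dj Y))⁻¹ * ‖V Y B‖ ≤ a₂₀ / 2 * (B ⬝ᵥ B) + w) (ha0 : 0 ≤ a₂₀)
    -- located bonds
    (locΛ : Λ → (Fin ν → ℤ)) (locN : Λ ⊕ C₀ → (Fin ν → ℤ)) {m : ℕ}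
    (hfibΛ : ∀ x : Fin ν → ℤ, (Finset.univ.filter fun i => locΛ i = x).card ≤ m)
    (hfibN : ∀ x : Fin ν → ℤ, (Finset.univ.filter fun j => locN j = x).card ≤ m)
    -- rates and constants
    {kap kap' kap'' θ θE θΓ θC KG KΓ KCs K₀ : ℝ} (hkap'' : 0 < kap'') (h1 : kap'' < kap') (h2 : kap' < kap)
    (hθE : 0 ≤ θE) (hθΓ : 0 ≤ θΓ) (hθC : 0 ≤ θC) (hKG : 0 ≤ KG) (hKΓ : 0 ≤ KΓ) (hKCs : 0 ≤ KCs) (hK₀ : 0 ≤ K₀)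
    (hθEle : θE ≤ θ) (hθΓle : θΓ ≤ θ)
    (hθR1le : (m * (1 + 2 / (kap - kap')) ^ ν) * (m * (1 + 2 / (kap' - kap'')) ^ ν)
      * (θΓ * KCs * KG + KΓ * θC * KG + KΓ * K₀ * θΓ) ≤ θ)
    -- uniform localisation of the primitive kernels (L17a)
    (hG : ∀ σ : Cell Bk1 → ℂ, (∀ j, ‖σ j‖ ≤ Real.exp c.κ₁) →
      ∀ b j, ‖G σ b j‖ ≤ KG * Real.exp (-(kap * l1dist (locΛ b) (locN j))))
    (hΓ₀ : ∀ b j, ‖Γ₀ b j‖ ≤ KΓ * Real.exp (-(kap * l1dist (locΛ b) (locN j))))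
    (hCs : ∀ σ : Cell Bk1 → ℂ, (∀ j, ‖σ j‖ ≤ Real.exp c.κ₁) →
      ∀ b b', ‖(A σ)⁻¹ b b'‖ ≤ KCs * Real.exp (-(kap * l1dist (locΛ b) (locΛ b'))))
    (hC216 : ∀ b b', ‖C b b'‖ ≤ K₀ * Real.exp (-(kap * l1dist (locΛ b) (locΛ b'))))
    -- the (2.16)-type differences of the primitive kernels (L16a)
    (hdΓ : ∀ σ : Cell Bk1 → ℂ, (∀ j, ‖σ j‖ ≤ Real.exp c.κ₁) →
      ∀ b j, ‖(G σ - Γ₀.map (algebraMap ℝ ℂ)) b j‖ ≤ θΓ * Real.exp (-(kap * l1dist (locΛ b) (locN j))))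
    (hdC : ∀ σ : Cell Bk1 → ℂ, (∀ j, ‖σ j‖ ≤ Real.exp c.κ₁) →
      ∀ b b', ‖((A σ)⁻¹ - C.map (algebraMap ℝ ℂ)) b b'‖ ≤ θC * Real.exp (-(kap * l1dist (locΛ b) (locΛ b'))))
    (hdE : ∀ σ : Cell Bk1 → ℂ, (∀ j, ‖σ j‖ ≤ Real.exp c.κ₁) →
      ∀ b b', ‖(A σ - C⁻¹.map (algebraMap ℝ ℂ)) b b'‖ ≤ θE * Real.exp (-(kap * l1dist (locΛ b) (locΛ b'))))
    (hsmallKθ : K₀ * (m * (1 + 2 / kap) ^ ν) * (θ * (m * (1 + 2 / kap'') ^ ν)) < 1)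
    -- the (2.24)–(2.25) smallness
    {cE g : ℝ} (hc0 : 0 ≤ cE) (hc : ∀ k, hC.1.eigenvalues k ≤ cE)
    (hαc : (2 * (θ * (m * (1 + 2 / kap'') ^ ν)) + (γ₂ + a₂₀)) * cE ≤ 1 / 2) (hg : 0 ≤ g)
    (hΓq : ∀ X : Λ ⊕ C₀ → ℝ, (Γ₀ *ᵥ X) ⬝ᵥ (C *ᵥ (Γ₀ *ᵥ X)) ≤ g * (X ⬝ᵥ X))
    (hsmall : (2 * (θ * (m * (1 + 2 / kap'') ^ ν)) + (γ₂ + a₂₀)) * (1 + 2 * cE * g) ≤ 1 / 2)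
    -- constant matching, p. 17: the |P|-rate of the weight and «exp O(1)α₅|Z|»
    {a a₅ : ℝ} (hPa : a ≤ γ₂ * rP ^ 2)
    (hvol : 2 * (K₀ * (m * (1 + 2 / kap) ^ ν) * (θ * (m * (1 + 2 / kap'') ^ ν))
              * (1 + (1 - K₀ * (m * (1 + 2 / kap) ^ ν) * (θ * (m * (1 + 2 / kap'') ^ ν)))⁻¹) / 2)
          * (Fintype.card Λ : ℝ)
        + w + (2 * (θ * (m * (1 + 2 / kap'') ^ ν)) + (γ₂ + a₂₀)) * cE * (Fintype.card Λ : ℝ)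
        + (2 * (θ * (m * (1 + 2 / kap'') ^ ν)) + (γ₂ + a₂₀)) * (1 + 2 * cE * g) * (Fintype.card (Λ ⊕ C₀) : ℝ)
        ≤ a₅ * ((cellsOf Bk1 Z.1).card : ℝ)) :
    ‖term214 r lZ lD (core214 A Γ (F214 t.2.card χY₀ χcP Dfam V)) 0 0‖ ≤
      weight c L M Z a t * Real.exp (a₅ * ((cellsOf Bk1 Z.1).card : ℝ)) := by
  obtain ⟨hlZ1, hlZ2⟩ := hlZ
  obtain ⟨hlD1, hlD2⟩ := hlD
  -- the τ-radii `|τ(Y)| = (invTau …)⁻¹ ≥ 2`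
  have hR2 : ∀ Y : Dom Bk, (2 : ℝ) ≤ (invTau c ((sys Bk).dj Y))⁻¹ := fun Y => by
    rw [le_inv_comm₀ (by norm_num) (hpos Y)]; simpa [one_div] using hhalf Y
  have h := norm_term214_le_226_of_primitives (ι := Cell Bk1) (κ := Dom Bk) hκ₁
    (fun Y : Dom Bk => (invTau c ((sys Bk).dj Y))⁻¹) hR2 hUσ hUτ hUexp hUtau hr hr' hsubτ A Γ t.2.card χY₀ χcP
    hχ0 hχc0 Dfam V hΨσ hΨτ hC Γ₀ hAs hA G hlin qP h222 hγ₂ hqP h220R ha0 locΛ locN hfibΛ hfibN hkap'' h1 h2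
    hθE hθΓ hθC hKG hKΓ hKCs hK₀ hθEle hθΓle hθR1le hG hΓ₀ hCs hC216 hdΓ hdC hdE hsmallKθ hc0 hc hαc hg hΓq
    hsmall hlZ1 hlD1 (σ₀ := 0) (fun _ => by simp) (τ₀ := 0) (fun _ => by simp)
  -- `|lZ| = #cells(Z∖Z′₀)` and `2/|τ(Y)| = α₆ε₂e^{−(1−3δ)κd_k(Y)}`
  have hlen : ((lZ.length : ℕ) : ℝ) =
      ((cellsOf Bk1 (Z.1 \ closureIdx L (collar (Z0 M t)))).card : ℝ) := by
    rw [← List.toFinset_card_of_nodup hlZ1, hlZ2]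
  have hprod : (∏ Y ∈ lD.toFinset, 2 * ((invTau c ((sys Bk).dj Y))⁻¹)⁻¹) =
      ∏ Y ∈ t.1, c.α₆ * c.eps2 * Real.exp (-((1 - 3 * c.δ) * c.κ * (sys Bk).dj Y)) := by
    rw [hlD2]
    refine Finset.prod_congr rfl fun Y _ => ?_
    rw [inv_inv, two_mul_invTau_eq c hα₆]
    ring_nf
  -- the volume factors and the |P|-rate (p. 17)
  have hP0 : (0 : ℝ) ≤ (t.2.card : ℕ) := Nat.cast_nonneg _
  have hPrate : -(γ₂ / 2 * rP ^ 2 * (t.2.card : ℕ)) ≤ -(a / 2 * (t.2.card : ℝ)) := by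
    have := mul_le_mul_of_nonneg_right hPa hP0
    linarith
  have hGauss :
      Real.exp (2 * (K₀ * (m * (1 + 2 / kap) ^ ν) * (θ * (m * (1 + 2 / kap'') ^ ν))
              * (1 + (1 - K₀ * (m * (1 + 2 / kap) ^ ν) * (θ * (m * (1 + 2 / kap'') ^ ν)))⁻¹) / 2)
            * (Fintype.card Λ : ℝ))
          * Real.exp (-(γ₂ / 2 * rP ^ 2 * ((t.2.card : ℕ) : ℝ)) + w)
          * (Real.exp ((2 * (θ * (m * (1 + 2 / kap'') ^ ν)) + (γ₂ + a₂₀)) * cE * (Fintype.card Λ : ℝ))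
            * Real.exp ((2 * (θ * (m * (1 + 2 / kap'') ^ ν)) + (γ₂ + a₂₀)) * (1 + 2 * cE * g)
              * (Fintype.card (Λ ⊕ C₀) : ℝ))) ≤
        Real.exp (-(a / 2 * (t.2.card : ℝ))) * Real.exp (a₅ * ((cellsOf Bk1 Z.1).card : ℝ)) := by
    rw [← Real.exp_add, ← Real.exp_add, ← Real.exp_add, ← Real.exp_add, Real.exp_le_exp]
    linarith
  have hF12 : 0 ≤ Real.exp (-(c.κ₁ - 1) * lZ.length) *
      ∏ Y ∈ lD.toFinset, 2 * ((invTau c ((sys Bk).dj Y))⁻¹)⁻¹ :=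
    mul_nonneg (Real.exp_nonneg _)
      (Finset.prod_nonneg fun Y _ => mul_nonneg zero_le_two (inv_nonneg.2 (inv_nonneg.2 (hpos Y).le)))
  refine h.trans ((mul_le_mul_of_nonneg_left hGauss hF12).trans (le_of_eq ?_))
  rw [hprod, weight, ← hlen]
  ring_nf

end

end Literature.MathematicalPhysics.QuantumFieldTheory.Balaban1983to89.B13Lemma3WindowPrimitive
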